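import Literature.Barriers.AtomisticToContinuum.AnticontinuumLocalizationThm1Window
import Literature.Barriers.AtomisticToContinuum.AnticontinuumLocalizationProofs
import HarnessLib

/-!
# De Roeck–Huveneers 2015, Theorem 1: transplanting window objects into the chain

`Literature/Barriers/AtomisticToContinuum/` — first half of the proof of
"window solutions ⟹ `DeRoeckHuveneers2015_thm1`" (the window form of Theorem 1 of
De Roeck–Huveneers, CPAM 68 (2015), arXiv:1305.5127, recorded in
`AnticontinuumLocalizationThm1Window.lean`, implies the chain form of the main file).

Pure calculus on the lifted phase spaces, no measure theory: for the window
`S = [a-(M+1), a+M+1] ∩ [0, N-1]` of the `N`-chain around the bond `(a, a+1)` (`windowEmb`,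
`windowProj`, `windowBond` of the window file) and a function `U` on the window phase space that
depends only on the sites within distance `M` of `b = a - lo`,

* coordinate derivatives of `U ∘ windowProj` are those of `U` at window sites and vanish elsewhere
  (`partialQ_comp_windowProj`, `partialQ_comp_windowProj_eq_zero`, and the `P` versions);
* the forces agree at the sites that matter (`forceCore_windowEmb`): a window site within distance
  `M` of `b` is either interior to the window or a true end of the chain, so `∂_{q_x} H_N` there is
  `∂_{q_i} H_S` of the free chain on the window;
* hence **`L_{H_N}(U ∘ π) = (L_{H_S} U) ∘ π`** (`liouville_comp_windowProj`) — the identity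
  `ε J = L_H U + ε^{n+1} G` passes from the window to the chain (`bondCurrent_windowEmb`);
* smoothness, angle-periodicity and locality pass to `U ∘ π` (`contDiff_comp_windowProj`,
  `isAnglePeriodic_comp_windowProj`, `dependsOnlyNear_comp_windowProj`), and `L_H`, `∂_♯` ignore
  additive constants (`liouville_sub_const`, …) — used for the mean-zero normalisation of `U_a`.

All proved, theorem-only. [cite: DeRoeckHuveneers2015, §5.3 ("Locality")]
-/

noncomputable section

open Function Set
open scoped ContDiff

namespace Literature.Barriers.AtomisticToContinuum.HeatConduction.RotorChain

open Literature.MathematicalPhysics.KineticTheory.HeatConduction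

variable {N : ℕ}

/-! ### Updating a coordinate commutes with the window restriction -/

/-- Updating an angle at a window site commutes with the restriction. [folklore] -/
theorem windowProj_update_fst (a : Fin N) (M : ℕ) (z : PhaseSpace N) (i : Fin (windowSize a M)) (t : ℝ) :
    windowProj a M (update z.1 (windowEmb a M i) t, z.2) =
      (update (windowProj a M z).1 i t, (windowProj a M z).2) := by
  refine Prod.ext (funext fun j => ?_) rfl
  simp only [windowProj_fst, update_apply, (windowEmb_injective a M).eq_iff]

/-- Updating a momentum at a window site commutes with the restriction. [folklore] -/
theorem windowProj_update_snd (a : Fin N) (M : ℕ) (z : PhaseSpace N) (i : Fin (windowSize a M)) (t : ℝ) :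
    windowProj a M (z.1, update z.2 (windowEmb a M i) t) =
      ((windowProj a M z).1, update (windowProj a M z).2 i t) := by
  refine Prod.ext rfl (funext fun j => ?_)
  simp only [windowProj_snd, update_apply, (windowEmb_injective a M).eq_iff]

/-- Updating an angle outside the window does not change the restriction. [folklore] -/
theorem windowProj_update_fst_of_forall_ne (a : Fin N) (M : ℕ) (z : PhaseSpace N) {x : Fin N}
    (hx : ∀ i, windowEmb a M i ≠ x) (t : ℝ) :
    windowProj a M (update z.1 x t, z.2) = windowProj a M z := by
  refine Prod.ext (funext fun j => ?_) rfl
  simp only [windowProj_fst, update_of_ne (hx j)]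

/-- Updating a momentum outside the window does not change the restriction. [folklore] -/
theorem windowProj_update_snd_of_forall_ne (a : Fin N) (M : ℕ) (z : PhaseSpace N) {x : Fin N}
    (hx : ∀ i, windowEmb a M i ≠ x) (t : ℝ) :
    windowProj a M (z.1, update z.2 x t) = windowProj a M z := by
  refine Prod.ext rfl (funext fun j => ?_)
  simp only [windowProj_snd, update_of_ne (hx j)]

/-! ### Coordinate derivatives of `U ∘ π` -/

/-- `∂_{q_{lo+i}} (U ∘ π) = (∂_{q_i} U) ∘ π`. [folklore] -/
theorem partialQ_comp_windowProj (a : Fin N) (M : ℕ) (U : PhaseSpace (windowSize a M) → ℝ)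
    (z : PhaseSpace N) (i : Fin (windowSize a M)) :
    partialQ (windowEmb a M i) (U ∘ windowProj a M) z = partialQ i U (windowProj a M z) := by
  unfold partialQ
  simp only [comp_apply, windowProj_update_fst]
  rfl

/-- `∂_{ω_{lo+i}} (U ∘ π) = (∂_{ω_i} U) ∘ π`. [folklore] -/
theorem partialP_comp_windowProj (a : Fin N) (M : ℕ) (U : PhaseSpace (windowSize a M) → ℝ)
    (z : PhaseSpace N) (i : Fin (windowSize a M)) :
    partialP (windowEmb a M i) (U ∘ windowProj a M) z = partialP i U (windowProj a M z) := by
  unfold partialP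
  simp only [comp_apply, windowProj_update_snd]
  rfl

/-- `∂_{q_x} (U ∘ π) = 0` at sites `x` outside the window. [folklore] -/
theorem partialQ_comp_windowProj_eq_zero (a : Fin N) (M : ℕ) (U : PhaseSpace (windowSize a M) → ℝ)
    (z : PhaseSpace N) {x : Fin N} (hx : ∀ i, windowEmb a M i ≠ x) :
    partialQ x (U ∘ windowProj a M) z = 0 := by
  unfold partialQ
  simp only [comp_apply, windowProj_update_fst_of_forall_ne a M z hx, deriv_const]

/-- `∂_{ω_x} (U ∘ π) = 0` at sites `x` outside the window. [folklore] -/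
theorem partialP_comp_windowProj_eq_zero (a : Fin N) (M : ℕ) (U : PhaseSpace (windowSize a M) → ℝ)
    (z : PhaseSpace N) {x : Fin N} (hx : ∀ i, windowEmb a M i ≠ x) :
    partialP x (U ∘ windowProj a M) z = 0 := by
  unfold partialP
  simp only [comp_apply, windowProj_update_snd_of_forall_ne a M z hx, deriv_const]

/-! ### The forces of the chain and of the window agree near the bond -/

/-- The neighbour sums of `forceCore` made explicit. [folklore] -/
theorem forceCore_eq (K : ℕ) (γ : ℝ) (q : Fin K → ℝ) (x : Fin K) :
    forceCore K γ q x = γ * Real.sin (q x) +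
      (if h : x.val + 1 < K then Real.sin (q x - q ⟨x.val + 1, h⟩) else 0) -
      (if h : 0 < x.val then Real.sin (q ⟨x.val - 1, by omega⟩ - q x) else 0) := by
  unfold forceCore
  congr 2
  · by_cases h : x.val + 1 < K
    · rw [dif_pos h, Finset.sum_eq_single_of_mem (⟨x.val + 1, h⟩ : Fin K) (Finset.mem_univ _)
        (fun y _ hy => if_neg fun e => hy (Fin.ext e))]
      simp
    · rw [dif_neg h]
      exact Finset.sum_eq_zero fun y _ => if_neg (by have := y.isLt; omega)
  · by_cases h : 0 < x.val
    · rw [dif_pos h, Finset.sum_eq_single_of_mem (⟨x.val - 1, by omega⟩ : Fin K) (Finset.mem_univ _)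
        (fun y _ hy => if_neg fun e => hy (Fin.ext (by simp only; omega)))]
      rw [if_pos (by simp only; omega)]
    · rw [dif_neg h]
      exact Finset.sum_eq_zero fun y _ => if_neg (by omega)

/-- At a window site within distance `M` of `b`, the force of the `N`-chain is the force of the
free chain on the window. [folklore] -/
theorem forceCore_windowEmb (a : Fin N) (M : ℕ) (γ : ℝ) (z : PhaseSpace N) (i : Fin (windowSize a M))
    (hi : |(i.val : ℝ) - (windowBond a M).val| ≤ M) :
    forceCore N γ z.1 (windowEmb a M i) = forceCore (windowSize a M) γ (windowProj a M z).1 i := by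
  rw [abs_sub_le_natCast_iff] at hi
  rw [forceCore_eq, forceCore_eq]
  have hsucc := windowEmb_succ_lt_iff i hi.1
  have hpos := windowEmb_pos_iff i hi.2
  have h1 : (if h : (windowEmb a M i).val + 1 < N then
        Real.sin (z.1 (windowEmb a M i) - z.1 ⟨(windowEmb a M i).val + 1, h⟩) else 0) =
      (if h : i.val + 1 < windowSize a M then
        Real.sin ((windowProj a M z).1 i - (windowProj a M z).1 ⟨i.val + 1, h⟩) else 0) := by
    by_cases h : i.val + 1 < windowSize a M
    · rw [dif_pos h, dif_pos (hsucc.2 h)]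
      rfl
    · rw [dif_neg h, dif_neg (fun h' => h (hsucc.1 h'))]
  have h2 : (if h : 0 < (windowEmb a M i).val then
        Real.sin (z.1 ⟨(windowEmb a M i).val - 1, by omega⟩ - z.1 (windowEmb a M i)) else 0) =
      (if h : 0 < i.val then
        Real.sin ((windowProj a M z).1 ⟨i.val - 1, by omega⟩ - (windowProj a M z).1 i) else 0) := by
    by_cases h : 0 < i.val
    · rw [dif_pos h, dif_pos (hpos.2 h)]
      simp only [windowProj_fst]
      have he : (⟨(windowEmb a M i).val - 1, by have := (windowEmb a M i).isLt; omega⟩ : Fin N) =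
          windowEmb a M ⟨i.val - 1, by omega⟩ := by
        apply Fin.ext
        have hv : (windowEmb a M i).val = windowLo a M + i.val := rfl
        simp only [windowEmb_val]
        omega
      rw [he]
    · rw [dif_neg h, dif_neg (fun h' => h (hpos.1 h'))]
  rw [h1, h2]
  rfl

/-- The bond current through `(a, a+1)` is the bond current of the window through `(b, b+1)`.
[folklore] -/
theorem bondCurrent_windowEmb (a : Fin N) (M : ℕ) (z : PhaseSpace N) :
    bondCurrent N a z = bondCurrent (windowSize a M) (windowBond a M) (windowProj a M z) := by
  have key : ∀ (K : ℕ) (c : Fin K) (w : PhaseSpace K), bondCurrent K c w =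
      if h : c.val + 1 < K then w.2 ⟨c.val + 1, h⟩ * Real.sin (w.1 c - w.1 ⟨c.val + 1, h⟩) else 0 := by
    intro K c w
    unfold bondCurrent
    by_cases h : c.val + 1 < K
    · rw [dif_pos h, Finset.sum_eq_single_of_mem (⟨c.val + 1, h⟩ : Fin K) (Finset.mem_univ _)
        (fun y _ hy => if_neg fun e => hy (Fin.ext e))]
      simp
    · rw [dif_neg h]
      exact Finset.sum_eq_zero fun y _ => if_neg (by have := y.isLt; omega)
  rw [key, key]
  have hsucc := windowEmb_succ_lt_iff (a := a) (M := M) (windowBond a M) (Nat.le_add_right _ _)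
  rw [windowEmb_windowBond] at hsucc
  by_cases h : (windowBond a M).val + 1 < windowSize a M
  · rw [dif_pos h, dif_pos (hsucc.2 h)]
    simp only [windowProj_fst, windowProj_snd, windowEmb_windowBond]
    have he : windowEmb a M ⟨(windowBond a M).val + 1, h⟩ = ⟨a.val + 1, hsucc.2 h⟩ := by
      apply Fin.ext
      simp only [windowEmb_val, windowBond_val]
      have := windowLo_le a M
      omega
    rw [he]
  · rw [dif_neg h, dif_neg (fun h' => h (hsucc.1 h'))]

/-! ### `L_{H_N} (U ∘ π) = (L_{H_S} U) ∘ π` -/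

/-- **Transplanting the Liouville operator**: for a window function `U` depending only on the sites
within distance `M` of `b`, `L_{H_N}(U ∘ π)(z) = (L_{H_S} U)(π z)` — the free chain on the window
`S` sees the same forces at those sites, and the remaining window sites (the cut edges, at distance
`M + 1`) do not enter. [cite: DeRoeckHuveneers2015, §5.3] -/
theorem liouville_comp_windowProj (a : Fin N) (M : ℕ) {U : PhaseSpace (windowSize a M) → ℝ}
    (hU : DependsOnlyNear (windowSize a M) (windowBond a M) M U) (ε γ : ℝ) (z : PhaseSpace N) :
    liouville N ε γ (U ∘ windowProj a M) z = liouville (windowSize a M) ε γ U (windowProj a M z) := by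
  unfold liouville
  set e : Fin (windowSize a M) ↪ Fin N := ⟨windowEmb a M, windowEmb_injective a M⟩ with he
  -- sites outside the window do not contribute
  rw [← Finset.sum_subset (Finset.subset_univ (Finset.univ.map e))]
  swap
  · intro x _ hx
    have hx' : ∀ i, windowEmb a M i ≠ x := fun i h => hx (Finset.mem_map.2 ⟨i, Finset.mem_univ _, h⟩)
    rw [partialQ_comp_windowProj_eq_zero a M U z hx', partialP_comp_windowProj_eq_zero a M U z hx']
    ring
  rw [Finset.sum_map]
  refine Finset.sum_congr rfl fun i _ => ?_
  simp only [he, Function.Embedding.coeFn_mk]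
  rw [partialQ_comp_windowProj, partialP_comp_windowProj, partialP_hamiltonian, partialP_hamiltonian,
    partialQ_hamiltonian, partialQ_hamiltonian, windowProj_snd]
  by_cases hi : |(i.val : ℝ) - (windowBond a M).val| ≤ M
  · rw [force, force, forceCore_windowEmb a M γ z i hi]
  · rw [not_le] at hi
    rw [hU.partialQ_eq_zero hi, hU.partialP_eq_zero hi]
    ring

/-! ### Smoothness, periodicity, locality of `U ∘ π`; additive constants -/

/-- The window restriction is a continuous linear map, hence smooth. [folklore] -/
theorem contDiff_windowProj (a : Fin N) (M : ℕ) {n : WithTop ℕ∞} : ContDiff ℝ n (windowProj a M) := by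
  unfold windowProj
  apply ContDiff.prodMk
  · exact contDiff_pi.2 fun i => (contDiff_apply ℝ ℝ (windowEmb a M i)).comp contDiff_fst
  · exact contDiff_pi.2 fun i => (contDiff_apply ℝ ℝ (windowEmb a M i)).comp contDiff_snd

/-- Smoothness passes to `U ∘ π`. [folklore] -/
theorem contDiff_comp_windowProj (a : Fin N) (M : ℕ) {n : WithTop ℕ∞}
    {U : PhaseSpace (windowSize a M) → ℝ} (hU : ContDiff ℝ n U) : ContDiff ℝ n (U ∘ windowProj a M) :=
  hU.comp (contDiff_windowProj a M)

/-- Angle-periodicity passes to `U ∘ π`. [folklore] -/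
theorem isAnglePeriodic_comp_windowProj (a : Fin N) (M : ℕ) {U : PhaseSpace (windowSize a M) → ℝ}
    (hU : IsAnglePeriodic (windowSize a M) U) : IsAnglePeriodic N (U ∘ windowProj a M) := by
  intro z x
  simp only [comp_apply]
  by_cases hx : ∃ i, windowEmb a M i = x
  · obtain ⟨i, rfl⟩ := hx
    rw [windowProj_update_fst]
    exact hU (windowProj a M z) i
  · push Not at hx
    rw [windowProj_update_fst_of_forall_ne a M z hx]

/-- Locality passes to `U ∘ π`: distance `≤ M` from `b` in the window is distance `≤ M` from `a`
in the chain. [folklore] -/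
theorem dependsOnlyNear_comp_windowProj (a : Fin N) (M : ℕ) {R : ℝ} {U : PhaseSpace (windowSize a M) → ℝ}
    (hU : DependsOnlyNear (windowSize a M) (windowBond a M) R U) :
    DependsOnlyNear N a R (U ∘ windowProj a M) := by
  intro z z' h
  simp only [comp_apply]
  refine hU _ _ fun i hi => ?_
  have h' := h (windowEmb a M i) (by rwa [abs_windowEmb_sub])
  exact ⟨h'.1, h'.2⟩

/-- Locality is monotone in the radius. [folklore] -/
theorem DependsOnlyNear.mono {K : ℕ} {c : Fin K} {R R' : ℝ} {F : PhaseSpace K → ℝ}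
    (hF : DependsOnlyNear K c R F) (hRR' : R ≤ R') : DependsOnlyNear K c R' F :=
  fun z z' h => hF z z' fun x hx => h x (hx.trans hRR')

/-- Locality of a difference with a constant. [folklore] -/
theorem DependsOnlyNear.sub_const {K : ℕ} {c : Fin K} {R : ℝ} {F : PhaseSpace K → ℝ}
    (hF : DependsOnlyNear K c R F) (C : ℝ) : DependsOnlyNear K c R fun z => F z - C :=
  fun z z' h => by simp only [hF z z' h]

/-- `∂_{q_x}` ignores additive constants. [folklore] -/
theorem partialQ_sub_const {K : ℕ} (x : Fin K) (F : PhaseSpace K → ℝ) (C : ℝ) (z : PhaseSpace K) :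
    partialQ x (fun w => F w - C) z = partialQ x F z := by
  unfold partialQ
  exact deriv_sub_const (f := fun t => F (update z.1 x t, z.2)) C

/-- `∂_{p_x}` ignores additive constants. [folklore] -/
theorem partialP_sub_const {K : ℕ} (x : Fin K) (F : PhaseSpace K → ℝ) (C : ℝ) (z : PhaseSpace K) :
    partialP x (fun w => F w - C) z = partialP x F z := by
  unfold partialP
  exact deriv_sub_const (f := fun t => F (z.1, update z.2 x t)) C

/-- `L_H` ignores additive constants. [folklore] -/
theorem liouville_sub_const {K : ℕ} (ε γ : ℝ) (F : PhaseSpace K → ℝ) (C : ℝ) (z : PhaseSpace K) :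
    liouville K ε γ (fun w => F w - C) z = liouville K ε γ F z := by
  unfold liouville
  simp only [partialQ_sub_const, partialP_sub_const]

/-- Angle-periodicity of a difference with a constant. [folklore] -/
theorem IsAnglePeriodic.sub_const {K : ℕ} {F : PhaseSpace K → ℝ} (hF : IsAnglePeriodic K F) (C : ℝ) :
    IsAnglePeriodic K fun z => F z - C :=
  fun z x => by simp only [hF z x]

end Literature.Barriers.AtomisticToContinuum.HeatConduction.RotorChain

end
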